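import Mathlib
import Summits.Schanuel.Statement
import Literature.NumberTheory.Transcendental.SchanuelEclEmptyProofs
import Literature.NumberTheory.Transcendental.PiTranscendenceMeasureMain
import Literature.NumberTheory.Transcendental.DiazGrid
import Literature.NumberTheory.Transcendental.ExpAlgebraicApproximationMeasure
import Literature.NumberTheory.Transcendental.PiAlgebraicApproximationMeasure
import HarnessLib

/-!
# RootDecomp1KHyper — part 1/18 of the «HyperCarving» port wave (lens 6, gen 9 = ROUND 4 of route-Schanuel-RootDecomp1K)

Mechanical port (census-1 gen 7, dependency closure; tools census/tools/gen7/portkit2.py + build_l6g9.py) of §17 of HOME/decomp-schanuel-lens-6/g9/HyperCarving.lean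
(sha256 aba5c91f…, 8041 l; critic CLEARED FOR TYPING 2026-08-30T13:33:07Z; writer PATH A″ rev 5–8) together with the §§0–16 declarations it depends on
(nothing of the node was in the tree before except RootDecomp1KLinLiouvilleSplit and the Literature fact NesterenkoWaldschmidt1996_thm_5_1).
This part: node lines 218–1109 (29 declarations: SB, SFset, trdeg_mono, trdeg_adjoin_le_mk, trdeg_adjoin_union_le, le_trdeg_adjoin_of_algebraicIndependent …).
All parts share the namespace `Summit.Schanuel.Schanuel.Theorems.RootDecomp1KHyper` (node sub-namespace `HyperCell` reproduced); statements and proofs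
are the node's verbatim; `--supports stmt-Schanuel-33363` (A₄ʰ HyperLiouvilleSchanuel). Sorry-free; standard axioms. Nothing here proves Schanuel; rung 0.
-/

set_option linter.dupNamespace false
set_option linter.unusedSectionVars false

noncomputable section

open Complex IntermediateField Filter Polynomial

namespace Summit.Schanuel.Schanuel.Theorems.RootDecomp1KHyper

variable {n K : ℕ}

/-- Schanuel's bound at one tuple. -/
abbrev SB (n : ℕ) (z : Fin n → ℂ) : Prop :=
  (n : Cardinal) ≤ Algebra.trdeg ℚ ↥(IntermediateField.adjoin ℚ (Set.range z ∪ Set.range (cexp ∘ z)))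

/-- The generating set `{z, e^z}` of the Schanuel field of a tuple. -/
abbrev SFset {n : ℕ} (z : Fin n → ℂ) : Set ℂ := Set.range z ∪ Set.range (cexp ∘ z)

/-- `trdeg_ℚ` is monotone along inclusions of subfields (Mathlib `trdeg_le_of_injective`). -/
private theorem trdeg_mono {F E : Type*} [Field F] [Field E] [Algebra F E] {L L' : IntermediateField F E}
    (h : L ≤ L') : Algebra.trdeg F L ≤ Algebra.trdeg F L' :=
  trdeg_le_of_injective (IntermediateField.inclusion h) (IntermediateField.inclusion_injective h)

/-- A field generated by a set `S` has transcendence degree `≤ #S` (copy of the tree's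
`Literature.NumberTheory.Transcendental.trdeg_adjoin_le_mk`, module cone unbuilt tonight). -/
private theorem trdeg_adjoin_le_mk {F E : Type*} [Field F] [Field E] [Algebra F E] (S : Set E) :
    Algebra.trdeg F ↥(adjoin F S) ≤ Cardinal.mk S := by
  haveI := Literature.NumberTheory.Transcendental.isAlgebraic_adjoin_over_algebraAdjoin (F := F) S
  exact (Algebra.IsAlgebraic.trdeg_le_cardinalMk F (((↑) : adjoin F S → E) ⁻¹' S)).trans
    (Cardinal.mk_preimage_of_injective _ _ Subtype.val_injective)

set_option synthInstance.maxHeartbeats 400000 in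
/-- **Subadditivity** `trdeg_K K(S ∪ T) ≤ trdeg_K K(S) + trdeg_K K(T)` (copy of the tree's
`Literature.NumberTheory.Transcendental.trdeg_adjoin_union_le`, module cone unbuilt tonight). -/
private theorem trdeg_adjoin_union_le {K E : Type*} [Field K] [Field E] [Algebra K E] (S T : Set E) :
    Algebra.trdeg K ↥(adjoin K (S ∪ T)) ≤
      Algebra.trdeg K ↥(adjoin K S) + Algebra.trdeg K ↥(adjoin K T) := by
  have htower := trdeg_add_eq K (adjoin K S) (A := adjoin (adjoin K S) T)
  have heq : Algebra.trdeg K (adjoin (adjoin K S) T) = Algebra.trdeg K (adjoin K (S ∪ T)) := by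
    rw [← (equivOfEq (adjoin_adjoin_left K S T)).trdeg_eq]
    rfl
  have hbc := Literature.NumberTheory.Transcendental.trdeg_adjoin_le_of_le (K := K) (E := E)
    (F₁ := adjoin K (∅ : Set E)) (F₂ := adjoin K S) (adjoin.mono K _ _ (Set.empty_subset S)) T
  have htower0 := trdeg_add_eq K (adjoin K (∅ : Set E)) (A := adjoin (adjoin K (∅ : Set E)) T)
  have heq0 : Algebra.trdeg K (adjoin (adjoin K (∅ : Set E)) T) = Algebra.trdeg K (adjoin K T) := by
    have h1 : Algebra.trdeg K ↥(adjoin K T) = Algebra.trdeg K ↥(adjoin K (∅ ∪ T)) := by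
      rw [Set.empty_union]
    rw [h1, ← (equivOfEq (adjoin_adjoin_left K ∅ T)).trdeg_eq]
    rfl
  have hzero : Algebra.trdeg K ↥(adjoin K (∅ : Set E)) = 0 :=
    nonpos_iff_eq_zero.mp ((trdeg_adjoin_le_mk (F := K) (∅ : Set E)).trans (by simp))
  rw [hzero, zero_add, heq0] at htower0
  rw [heq] at htower
  rw [← htower, ← htower0]
  gcongr

/-- `k` algebraically independent numbers generate a field of transcendence degree `≥ k`. -/
private theorem le_trdeg_adjoin_of_algebraicIndependent {ι : Type} [Fintype ι] {y : ι → ℂ}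
    (h : AlgebraicIndependent ℚ y) :
    (Fintype.card ι : Cardinal) ≤ Algebra.trdeg ℚ ↥(adjoin ℚ (Set.range y)) := by
  let f : ι → adjoin ℚ (Set.range y) := fun i => ⟨y i, subset_adjoin ℚ _ ⟨i, rfl⟩⟩
  have hf : AlgebraicIndependent ℚ f := AlgebraicIndependent.of_comp (adjoin ℚ (Set.range y)).val h
  simpa using hf.cardinalMk_le_trdeg

/-- §3. Tools: Liouville numbers are transcendental; a Liouville real outside any finite span: auxiliary statement `transcendental_ofReal_of_liouville` (lens 6 gen 9 node, ported verbatim). -/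
theorem transcendental_ofReal_of_liouville {ℓ : ℝ} (hℓ : Liouville ℓ) :
    Transcendental ℚ (ℓ : ℂ) := by
  have h1 : Transcendental ℤ ℓ := hℓ.transcendental
  have h2 : Transcendental ℤ ((ℓ : ℝ) : ℂ) :=
    (transcendental_algebraMap_iff (R := ℤ) (S := ℝ) (A := ℂ) Complex.ofReal_injective).mpr h1
  exact fun h => h2 ((IsFractionRing.isAlgebraic_iff ℤ ℚ ℂ).mpr h)

/-- §3. Tools: Liouville numbers are transcendental; a Liouville real outside any finite span: auxiliary statement `isAlgebraic_I` (lens 6 gen 9 node, ported verbatim). -/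
private theorem isAlgebraic_I : IsAlgebraic ℚ Complex.I := by
  refine ⟨X ^ 2 + 1, ?_, ?_⟩
  · exact (Polynomial.monic_X_pow_add_C (1 : ℚ) two_ne_zero).ne_zero
  · simp [Complex.I_sq]

/-- Verbatim copy of the Literature named fact
`Literature.NumberTheory.Transcendental.NesterenkoWaldschmidt1996_thm_4_2`
(Nesterenko–Waldschmidt 1996, Thm 4(2): `|P(e)| ≥ exp(−1.3·10⁵ d² (log L + d))`), PROVED in the
tree (`NesterenkoWaldschmidt1996_thm_4_2_holds`, `ExpOneTranscendenceMeasureProofs.lean`); that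
module's cone is not built on the check farm tonight, so the anchor theorems take it as the
hypothesis `hNW` (discharged by name; `Iff.rfl` with the Literature def). -/
def NWMeasure : Prop :=
  ∀ (P : Polynomial ℤ) (d L : ℕ), P ≠ 0 → 1 ≤ d → P.natDegree ≤ d →
    (∑ k ∈ Finset.range (P.natDegree + 1), |P.coeff k|) ≤ (L : ℤ) → 3 ≤ L →
    Real.exp (-(1.3 * 10 ^ 5 * (d : ℝ) ^ 2 * (Real.log L + d))) ≤
      ‖Polynomial.aeval (Real.exp 1 : ℂ) P‖

/-- The length of an integer polynomial (sum of the absolute values of its coefficients). -/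
def len (P : ℤ[X]) : ℤ := ∑ k ∈ Finset.range (P.natDegree + 1), |P.coeff k|

/-- §6. The level-2 anchor: e is algebraically independent of every Liouville number: auxiliary statement `len_nonneg` (lens 6 gen 9 node, ported verbatim). -/
theorem len_nonneg (P : ℤ[X]) : 0 ≤ len P := Finset.sum_nonneg fun _ _ => abs_nonneg _

/-- §6. The level-2 anchor: e is algebraically independent of every Liouville number: auxiliary statement `len_le_of_natDegree_le` (lens 6 gen 9 node, ported verbatim). -/
theorem len_le_of_natDegree_le (P : ℤ[X]) {D : ℕ} (hD : P.natDegree ≤ D) :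
    len P ≤ ∑ k ∈ Finset.range (D + 1), |P.coeff k| :=
  Finset.sum_le_sum_of_subset_of_nonneg (Finset.range_mono (by omega)) fun _ _ _ => abs_nonneg _

/-- §6. The level-2 anchor: e is algebraically independent of every Liouville number: auxiliary statement `ofReal_exp_one` (lens 6 gen 9 node, ported verbatim). -/
theorem ofReal_exp_one : ((Real.exp 1 : ℝ) : ℂ) = cexp 1 := by
  rw [Complex.ofReal_exp, Complex.ofReal_one]

/-- `{j : Fin 2 // j ≠ 1}` has exactly one element. -/
@[reducible] def uniqueNeOne : Unique {j : Fin 2 // j ≠ 1} :=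
  ⟨⟨⟨0, by decide⟩⟩, fun ⟨j, hj⟩ => Subtype.ext (by
    fin_cases j
    · rfl
    · exact absurd rfl hj)⟩

/-- §6a. From algebraic dependence to an integer polynomial relation: auxiliary statement `image_compl_one` (lens 6 gen 9 node, ported verbatim). -/
private theorem image_compl_one (a b : ℂ) : (![a, b] : Fin 2 → ℂ) '' ({1}ᶜ : Set (Fin 2)) = {a} := by
  ext z
  simp only [Set.mem_image, Set.mem_compl_iff, Set.mem_singleton_iff]
  constructor
  · rintro ⟨j, hj, rfl⟩
    fin_cases j
    · rfl
    · exact absurd rfl hj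
  · rintro rfl
    exact ⟨0, by decide, rfl⟩

/-- A dependent pair with transcendental first coordinate: the second is algebraic over the first
(copy of `Literature.NumberTheory.Transcendental.Specialization.isAlgebraic_adjoin_of_not_algebraicIndependent`,
module unbuilt on the farm tonight). -/
private theorem isAlgebraic_adjoin_of_not_algebraicIndependent {a b : ℂ} (ha : Transcendental ℚ a)
    (h : ¬ AlgebraicIndependent ℚ ![a, b]) : IsAlgebraic (Algebra.adjoin ℚ ({a} : Set ℂ)) b := by
  rw [AlgebraicIndependent.iff_transcendental_adjoin_image (1 : Fin 2)] at h
  have h1 : AlgebraicIndependent ℚ (fun j : {j : Fin 2 // j ≠ 1} => (![a, b] : Fin 2 → ℂ) j) := by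
    letI := uniqueNeOne
    rw [algebraicIndependent_unique_type_iff]
    exact ha
  rw [image_compl_one] at h
  by_contra hb
  exact h ⟨h1, hb⟩

/-- §6a. From algebraic dependence to an integer polynomial relation: auxiliary statement `zsmul_eq_C_mul` (lens 6 gen 9 node, ported verbatim). -/
theorem zsmul_eq_C_mul (b : ℤ) (g : ℚ[X]) : b • g = C (b : ℚ) * g := by
  ext n
  simp

/-- An algebraic dependence between a transcendental `a` and `b` is witnessed by INTEGER
polynomials: `Σ_{k ≤ K} G_k(a) b^k = 0` with `G_K ≠ 0`. -/
theorem exists_int_relation {a b : ℂ} (ha : Transcendental ℚ a)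
    (h : ¬ AlgebraicIndependent ℚ ![a, b]) :
    ∃ (K : ℕ) (G : Fin (K + 1) → ℤ[X]), G (Fin.last K) ≠ 0 ∧
      ∑ k : Fin (K + 1), aeval a (G k) * b ^ (k : ℕ) = 0 := by
  obtain ⟨μ, hμ0, hμb⟩ := isAlgebraic_adjoin_of_not_algebraicIndependent ha h
  set A := Algebra.adjoin ℚ ({a} : Set ℂ) with hA
  -- each coefficient of μ is a rational polynomial in a
  have hcoef : ∀ k : ℕ, ∃ g : ℚ[X], aeval a g = ((μ.coeff k : A) : ℂ) := by
    intro k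
    have hm : ((μ.coeff k : A) : ℂ) ∈ (Polynomial.aeval a : ℚ[X] →ₐ[ℚ] ℂ).range :=
      (Algebra.adjoin_singleton_eq_range_aeval ℚ a).le (μ.coeff k).2
    exact (AlgHom.mem_range _).1 hm
  choose g hg using hcoef
  -- clear denominators coefficientwise
  have hnorm : ∀ k : ℕ, ∃ (G : ℤ[X]) (c : ℤ), c ≠ 0 ∧ G.map (Int.castRingHom ℚ) = c • g k := by
    intro k
    obtain ⟨c, hc, hG⟩ := IsLocalization.integerNormalization_spec (nonZeroDivisors ℤ) (g k)
    exact ⟨_, c, nonZeroDivisors.ne_zero hc, by simpa using hG⟩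
  choose G₀ c hc0 hG₀ using hnorm
  have haeval : ∀ k : ℕ, aeval a (G₀ k) = (c k : ℂ) * aeval a (g k) := by
    intro k
    have e1 : aeval a (G₀ k) = aeval a ((G₀ k).map (algebraMap ℤ ℚ)) := by
      rw [Polynomial.aeval_map_algebraMap]
    rw [e1, show algebraMap ℤ ℚ = Int.castRingHom ℚ from rfl, hG₀ k, zsmul_eq_C_mul, map_mul,
      aeval_C]
    simp
  set K := μ.natDegree with hK
  -- the relation Σ_k coeff_k(a) b^k = 0, as a `Fin (K+1)`-sum
  have hrel : ∑ k : Fin (K + 1), aeval a (g k) * b ^ (k : ℕ) = 0 := by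
    have h1 : aeval b μ = ∑ i ∈ Finset.range (K + 1), ((μ.coeff i : A) : ℂ) * b ^ i := by
      rw [Polynomial.aeval_def, Polynomial.eval₂_eq_sum_range]
      rfl
    rw [hμb] at h1
    rw [Finset.sum_range (fun i => ((μ.coeff i : A) : ℂ) * b ^ i)] at h1
    rw [h1]
    refine Finset.sum_congr rfl fun k _ => ?_
    rw [hg]
  refine ⟨K, fun k => C (∏ j ∈ Finset.univ.erase k, c j) * G₀ k, ?_, ?_⟩
  · -- the top coefficient is nonzero
    have hlead : μ.coeff K ≠ 0 := by
      rw [hK]; exact Polynomial.leadingCoeff_ne_zero.mpr hμ0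
    have hGK : G₀ K ≠ 0 := by
      intro h0
      have h1 : (c K : ℂ) * aeval a (g K) = 0 := by rw [← haeval, h0, map_zero]
      rcases mul_eq_zero.mp h1 with h | h
      · exact hc0 K (by exact_mod_cast h)
      · rw [hg] at h
        exact hlead (by exact_mod_cast h)
    show C (∏ j ∈ Finset.univ.erase (Fin.last K), c j) * G₀ (Fin.last K) ≠ 0
    rw [Fin.val_last]
    refine mul_ne_zero (Polynomial.C_ne_zero.mpr ?_) hGK
    exact Finset.prod_ne_zero_iff.mpr fun j _ => hc0 j
  · -- the relation, multiplied through by B = ∏ c_j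
    set B : ℤ := ∏ j : Fin (K + 1), c j with hB
    calc ∑ k : Fin (K + 1), aeval a (C (∏ j ∈ Finset.univ.erase k, c j) * G₀ k) * b ^ (k : ℕ)
        = ∑ k : Fin (K + 1), (B : ℂ) * (aeval a (g k) * b ^ (k : ℕ)) := by
          refine Finset.sum_congr rfl fun k _ => ?_
          have e2 : (((∏ j ∈ Finset.univ.erase k, c j : ℤ) : ℂ)) * (c k : ℂ) = (B : ℂ) := by
            rw [← Int.cast_mul, Finset.prod_erase_mul _ _ (Finset.mem_univ k)]
          rw [map_mul, aeval_C, haeval, ← e2]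
          simp only [eq_intCast]
          ring
      _ = (B : ℂ) * ∑ k : Fin (K + 1), aeval a (g k) * b ^ (k : ℕ) := by rw [Finset.mul_sum]
      _ = 0 := by rw [hrel, mul_zero]

/-- Near a real point `ℓ`, a nonzero complex polynomial has no real root other than (possibly) `ℓ`. -/
theorem exists_ball_eval_ne_zero (μ : ℂ[X]) (hμ : μ ≠ 0) (ℓ : ℝ) :
    ∃ δ : ℝ, 0 < δ ∧ ∀ r : ℝ, r ≠ ℓ → |r - ℓ| < δ → μ.eval (r : ℂ) ≠ 0 := by
  have hfin : {x : ℂ | μ.IsRoot x}.Finite := Polynomial.finite_setOf_isRoot hμ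
  set T : Set ℝ := (((↑) : ℝ → ℂ) ⁻¹' {x : ℂ | μ.IsRoot x}) \ {ℓ} with hT
  have hTfin : T.Finite :=
    (hfin.preimage fun x _ y _ hxy => Complex.ofReal_injective hxy).sdiff
  have hopen : Tᶜ ∈ nhds ℓ := hTfin.isClosed.isOpen_compl.mem_nhds fun h => h.2 rfl
  obtain ⟨δ, hδ, hball⟩ := Metric.mem_nhds_iff.mp hopen
  refine ⟨δ, hδ, fun r hr hrδ hroot => ?_⟩
  have hrT : r ∈ T := ⟨hroot, hr⟩
  have hrb : r ∈ Metric.ball ℓ δ := by rw [Metric.mem_ball, Real.dist_eq]; exact hrδ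
  exact hball hrb hrT

/-- Lipschitz bound at a real root: `‖μ(r)‖ ≤ M |r − ℓ|` for `|r − ℓ| ≤ 1`. -/
theorem exists_lipschitz_at_root (μ : ℂ[X]) (ℓ : ℝ) (hroot : μ.eval (ℓ : ℂ) = 0) :
    ∃ M : ℝ, 0 < M ∧ ∀ r : ℝ, |r - ℓ| ≤ 1 → ‖μ.eval (r : ℂ)‖ ≤ M * |r - ℓ| := by
  set ν := μ /ₘ (X - C (ℓ : ℂ)) with hν
  have hdvd : (X - C (ℓ : ℂ)) * ν = μ := Polynomial.mul_divByMonic_eq_iff_isRoot.mpr hroot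
  obtain ⟨M₀, hM₀⟩ := (isCompact_closedBall (ℓ : ℂ) 1).exists_bound_of_continuousOn
    (Polynomial.continuous ν).continuousOn
  refine ⟨max M₀ 0 + 1, by positivity, fun r hr => ?_⟩
  have hmem : (r : ℂ) ∈ Metric.closedBall (ℓ : ℂ) 1 := by
    rw [Metric.mem_closedBall, Complex.dist_eq, ← Complex.ofReal_sub, Complex.norm_real,
      Real.norm_eq_abs]
    exact hr
  have h1 : μ.eval (r : ℂ) = ((r : ℂ) - ℓ) * ν.eval (r : ℂ) := by
    conv_lhs => rw [← hdvd]
    rw [eval_mul, eval_sub, eval_X, eval_C]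
  rw [h1, norm_mul, ← Complex.ofReal_sub, Complex.norm_real, Real.norm_eq_abs]
  calc |r - ℓ| * ‖ν.eval (r : ℂ)‖ ≤ |r - ℓ| * M₀ := by gcongr; exact hM₀ _ hmem
    _ ≤ |r - ℓ| * (max M₀ 0 + 1) := by gcongr; linarith [le_max_left M₀ 0]
    _ = (max M₀ 0 + 1) * |r - ℓ| := mul_comm _ _

/-- The specialised integer polynomial `H_{p,q}(X) = Σ_k p^k q^{K−k} G_k(X)` (`= q^K P(X, p/q)`). -/
def specialise {K : ℕ} (G : Fin (K + 1) → ℤ[X]) (p : ℤ) (q : ℕ) : ℤ[X] :=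
  ∑ k : Fin (K + 1), C (p ^ (k : ℕ) * (q : ℤ) ^ (K - k)) * G k

/-- §6b. Analytic preliminaries: isolated roots, Lipschitz bound, specialisation: auxiliary statement `aeval_specialise` (lens 6 gen 9 node, ported verbatim). -/
theorem aeval_specialise {K : ℕ} (G : Fin (K + 1) → ℤ[X]) (p : ℤ) {q : ℕ} (hq : q ≠ 0) (a : ℂ) :
    aeval a (specialise G p q) =
      (q : ℂ) ^ K * ∑ k : Fin (K + 1), aeval a (G k) * ((p : ℂ) / q) ^ (k : ℕ) := by
  unfold specialise
  rw [map_sum, Finset.mul_sum]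
  refine Finset.sum_congr rfl fun k _ => ?_
  have hk : (k : ℕ) ≤ K := Nat.lt_succ_iff.mp k.2
  have hqC : (q : ℂ) ≠ 0 := by exact_mod_cast hq
  have hsplit : (q : ℂ) ^ K = (q : ℂ) ^ (k : ℕ) * (q : ℂ) ^ (K - k) := by
    rw [← pow_add, Nat.add_sub_cancel' hk]
  rw [map_mul, aeval_C, algebraMap_int_eq, eq_intCast]
  push_cast
  rw [hsplit, div_pow]
  field_simp

/-- §6b. Analytic preliminaries: isolated roots, Lipschitz bound, specialisation: auxiliary statement `natDegree_specialise_le` (lens 6 gen 9 node, ported verbatim). -/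
theorem natDegree_specialise_le {K : ℕ} (G : Fin (K + 1) → ℤ[X]) (p : ℤ) (q : ℕ) {D : ℕ}
    (hD : ∀ k, (G k).natDegree ≤ D) : (specialise G p q).natDegree ≤ D := by
  unfold specialise
  refine Polynomial.natDegree_sum_le_of_forall_le _ _ fun k _ => ?_
  exact (Polynomial.natDegree_C_mul_le _ _).trans (hD k)

/-- §6b. Analytic preliminaries: isolated roots, Lipschitz bound, specialisation: auxiliary statement `len_specialise_le` (lens 6 gen 9 node, ported verbatim). -/
theorem len_specialise_le {K : ℕ} (G : Fin (K + 1) → ℤ[X]) (p : ℤ) (q : ℕ) {D : ℕ}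
    (hD : ∀ k, (G k).natDegree ≤ D) :
    len (specialise G p q) ≤
      (|p| + q) ^ K * ∑ k : Fin (K + 1), ∑ i ∈ Finset.range (D + 1), |(G k).coeff i| := by
  have hdeg := natDegree_specialise_le G p q hD
  refine (len_le_of_natDegree_le _ hdeg).trans ?_
  have hpow : ∀ k : Fin (K + 1), |p ^ (k : ℕ) * (q : ℤ) ^ (K - k)| ≤ (|p| + q) ^ K := by
    intro k
    have hk : (k : ℕ) ≤ K := Nat.lt_succ_iff.mp k.2
    rw [abs_mul, abs_pow, abs_pow, Nat.abs_cast]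
    calc |p| ^ (k : ℕ) * (q : ℤ) ^ (K - k) ≤ (|p| + q) ^ (k : ℕ) * (|p| + q) ^ (K - k) := by
          gcongr
          · exact le_add_of_nonneg_right (by positivity)
          · exact le_add_of_nonneg_left (abs_nonneg p)
      _ = (|p| + q) ^ K := by rw [← pow_add, Nat.add_sub_cancel' hk]
  calc ∑ i ∈ Finset.range (D + 1), |(specialise G p q).coeff i|
      ≤ ∑ i ∈ Finset.range (D + 1), ∑ k : Fin (K + 1), (|p| + q) ^ K * |(G k).coeff i| := by
        refine Finset.sum_le_sum fun i _ => ?_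
        simp only [specialise, finsetSum_coeff, coeff_C_mul]
        refine (Finset.abs_sum_le_sum_abs _ _).trans (Finset.sum_le_sum fun k _ => ?_)
        rw [abs_mul]
        exact mul_le_mul_of_nonneg_right (hpow k) (abs_nonneg _)
    _ = (|p| + q) ^ K * ∑ k : Fin (K + 1), ∑ i ∈ Finset.range (D + 1), |(G k).coeff i| := by
        rw [Finset.sum_comm, Finset.mul_sum]
        refine Finset.sum_congr rfl fun k _ => ?_
        rw [Finset.mul_sum]

/-- **`PolyMeasure θ`** — `θ` has, in every degree `d`, a transcendence measure polynomial in
the length: `1 ≤ C · len(P)^τ · |P(θ)|` for all non-zero `P ∈ ℤ[X]` of degree `≤ d`.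
Equivalently (`H(P) ≤ len P ≤ (d+1)·H(P)`): `θ` is transcendental and no Mahler exponent
`w_d(θ)` is infinite, i.e. `θ` is an S- or a T-number (Baker 1975 Ch. 8; Bugeaud 2004 §3.1).
NOT Lang's «finite transcendence type» `|P(θ)| ≥ exp(−C (N + log H)^τ)` (the tree's
`HasTranscendenceType` / `ExpFiniteType`, `Theorems/DiophantineDichotomyDefs.lean`), which is
too weak for Liouville extraction (`exp(−C (log q)^τ) ≪ q^{−m}`). -/
def PolyMeasure (θ : ℂ) : Prop :=
  ∀ d : ℕ, ∃ (C : ℝ) (τ : ℕ), 0 < C ∧ ∀ P : ℤ[X], P ≠ 0 → P.natDegree ≤ d →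
    1 ≤ C * ((len P : ℤ) : ℝ) ^ τ * ‖aeval θ P‖

/-- §7. ROUND 2 (gen 7) — the abstract extraction: Mahler's class principle, formalised: auxiliary statement `one_le_len` (lens 6 gen 9 node, ported verbatim). -/
theorem one_le_len {P : ℤ[X]} (hP : P ≠ 0) : 1 ≤ len P := by
  have hlc : P.coeff P.natDegree ≠ 0 := Polynomial.leadingCoeff_ne_zero.mpr hP
  have hmem : P.natDegree ∈ Finset.range (P.natDegree + 1) := by simp
  calc (1 : ℤ) ≤ |P.coeff P.natDegree| := Int.one_le_abs hlc
    _ ≤ len P := Finset.single_le_sum (f := fun k => |P.coeff k|) (fun _ _ => abs_nonneg _) hmem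

/-- §7. ROUND 2 (gen 7) — the abstract extraction: Mahler's class principle, formalised: auxiliary statement `abs_coeff_le_len` (lens 6 gen 9 node, ported verbatim). -/
theorem abs_coeff_le_len (P : ℤ[X]) (k : ℕ) : |P.coeff k| ≤ len P := by
  by_cases hk : k ≤ P.natDegree
  · exact Finset.single_le_sum (f := fun k => |P.coeff k|) (fun _ _ => abs_nonneg _)
      (Finset.mem_range.mpr (Nat.lt_succ_of_le hk))
  · rw [Polynomial.coeff_eq_zero_of_natDegree_lt (not_le.mp hk), abs_zero]
    exact len_nonneg P

/-- A `PolyMeasure` forbids `P(θ) = 0`. -/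
theorem aeval_ne_zero_of_polyMeasure {θ : ℂ} (hθ : PolyMeasure θ) {P : ℤ[X]} (hP : P ≠ 0) :
    aeval θ P ≠ 0 := by
  intro h0
  obtain ⟨C, τ, _, h⟩ := hθ P.natDegree
  have h1 := h P hP le_rfl
  rw [h0, norm_zero, mul_zero] at h1
  exact absurd h1 (by norm_num)

/-- §7. ROUND 2 (gen 7) — the abstract extraction: Mahler's class principle, formalised: auxiliary statement `transcendental_of_polyMeasure` (lens 6 gen 9 node, ported verbatim). -/
theorem transcendental_of_polyMeasure {θ : ℂ} (hθ : PolyMeasure θ) : Transcendental ℚ θ := by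
  intro halg
  obtain ⟨P, hP0, hP⟩ := (IsFractionRing.isAlgebraic_iff ℤ ℚ ℂ).mpr halg
  exact aeval_ne_zero_of_polyMeasure hθ hP0 hP

end Summit.Schanuel.Schanuel.Theorems.RootDecomp1KHyper
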